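import Mathlib
import Literature.MathematicalPhysics.QuantumFieldTheory.MagnenRivasseauSeneor1993.MRS93InfinitesimalGauge
import HarnessLib

/-!
# Magnen–Rivasseau–Sénéor (CMP 155, 1993), Sect. VIII pp.377–378: the FUNCTIONAL-INTEGRAL side of (VIII.1)–(VIII.3)
# — «we perform a change of variables A → A + Dγ; by (infinitesimal) gauge invariance, there is no first order
# dependence in γ» — typed in READING (FD) (a finite-dimensional «formal Lebesgue measure»), the (VIII.2) density
# derived from the axial action on jets (READING (J)), and the step (VIII.2) → (VIII.3) «Integrating by parts and
# taking into account the fact that A_mD_m = A_m ∂/∂x^m» decomposed exactly, with an as-printed precision exhibited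

statement-level skeleton of a published FORMAL derivation with citation tags; finite-dimensional calculus and pointwise
jet algebra kernel-checked; nothing here is a claim about the Yang–Mills mass gap, about continuum Yang–Mills on `T⁴`
without infrared cutoff, or about the Clay problem — and nothing of Magnen–Rivasseau–Sénéor's analysis (expansions,
bounds, limits, the corrections `E_N`, `δ_N(ρ)`) is asserted or formalised

**Citation header (reproduction of PUBLISHED work).** J. Magnen, V. Rivasseau, R. Sénéor, *Construction of YM₄ with
an infrared cutoff*, Commun. Math. Phys. **155** (1993) 325–383 [MagnenRivasseauSeneor1993], Sect. VIII «Slavnov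
Identities» p.377 tl.14–27 ((VIII.1)–(VIII.3)) and p.378 tl.2–4; Sect. II.A p.328 tl.26–35 ((II.1)–(II.2)), p.329
tl.6–11 ((II.5)), tl.20–32 ((II.7), the axial gauge). Loci `p.NNN tl.nn` = journal page / text-layer line of the held
scan `paper:magnen1993-cmp155-mrs-ym4-infrared-cutoff` (PDF page = journal page − 324); the displays (VIII.1)–(VIII.6)
are read on the decoded page images `run/shared/lean/pub/lit-balaban/inprint/lit-balaban-p14/renders-cmp155/
p53_full_s6.png`, `p54_full_s6.png` (renders of record). Cell pub-balaban-gaps (YM blitz, track G3), seat mrs-lit-1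
(gen 7); companion prose `run/shared/lean/pub/pub-balaban-gaps/g3/MRS-AS-PRINTED.md` §2, §5. Builds on this seat's
`…MRS93InfinitesimalGauge` (jets `SectIV.FieldJet`/`GaugeJet`, (II.5) `covD`/`covDDer`, the line `gaugeLine`, the
first-order invariance `sum_sq_curvature_gaugeLine`, «A_mD_m = A_m∂_m» `dot_covD_eq_dot_der`) and on
`…MRS93TruncatedGauge` (the printed su(2) bracket `bracket`, `eps`).

**Edition v1.1** (whole-file resubmission of the accepted v1, every v1 declaration byte-identical): (i) the verbatim quotation of
(VIII.2) is corrected to the 2× crop `run/shared/lean/pub/pub-balaban-gaps/pub-balaban-gaps-mrs-lit-1/g7/renders/p53_crop_r2300-3200_s2.png`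
— the square bracket closes after `D^{ab}_m` and the last `∂/∂x⁰` stands OUTSIDE it: «[∂/∂x⁰ A^a_m · D^{ab}_m] ∂/∂x⁰» (v1, like the
quotations in `…SlavnovHierarchy` and `…InfinitesimalGauge`, wrote «[∂/∂x⁰ A^a_m · D^{ab}_m ∂/∂x⁰]»; TRANSCRIPTION NOTE (t): the
operator — `(∂₀A^a_m)·D^{ab}_m` followed by `∂₀`, acting on `γ^b` — is the same under either bracketing, so nothing typed changes);
(ii) one theorem added, `formalExpect_ward_vacuum` (the source-free member `⟨dS[V]⟩_S = 0` of the hierarchy, `N = 1`).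

**Why this file.** The tree types the Slavnov hierarchy (VIII.4)–(VIII.6) as PREDICATES on the statement-layer carrier
(`…MRS93MainStatement`: `SlavnovPrinted` = (VIII.6), the second conjunct of the main statement; `…MRS93SlavnovHierarchy`:
(VIII.4)/(VIII.5)), and the pointwise algebra behind «no first order dependence in γ» (`…MRS93InfinitesimalGauge` §3–§4).
Both files say explicitly that «nothing of the functional-integral side of (VIII.1)–(VIII.3) (the change of variables in
the measure, the source term J·Dγ, the integration by parts in x …) is typed». This file types exactly that side, in the
finite-dimensional reading the print itself invokes («the first expectation value is with respect to the formal Lebesgue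
measure», p.377 tl.18), and derives the displayed (VIII.2) density from the axial action.

**What the paper prints (verbatim, from the page images; p.377 [PDF 53] unless said).**
* tl.14–21, (VIII.1): *«To derive the exact form of Slavnov identities in the axial gauge, one introduces the generating
  functional for the theory with gauge condition A₀ = 0. Formally we can write this functional as: W(J) =
  ⟨e^{−F²/4+J·A}δ(A₀)⟩ = ⟨e^{J·A}⟩_ax, (VIII.1) where the first expectation value is with respect to the formal Lebesgue
  measure, and the second one is the expectation value in the axial gauge constructed by the limit process described
  above. The A field can be though of as the corresponding δ/δJ functional derivation.»*
* tl.22–25, (VIII.2): *«Then in (VIII.1) we perform a change of variables A → A + Dγ; by (infinitesimal) gauge invariance,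
  there is no first order dependence in γ, which gives the "Ward" or "Slavnov" equation:
  ⟨(J^a_m(x)D^{ab}_m(x) − [∂/∂x⁰ A^a_m · D^{ab}_m] ∂/∂x⁰) e^{J·A}⟩_ax = 0. (VIII.2)»*
* tl.26–27, (VIII.3): *«Integrating by parts and taking into account the fact that A_mD_m = A_m ∂/∂x^m we can rewrite this
  identity simply as: ⟨(J^a_m(x)D^{ab}_m(x) − [∂/∂x^m A^b_m(x)](∂/∂x⁰)²) e^{J·A}⟩_ax = 0. (VIII.3)»*
* tl.28–31: *«This identity gives rise to a hierarchy of identities with any number N of external sources. For instance the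
  two point function identity is obtained by applying one functional derivative δ/δJ(y) to (VIII.3) …»* ((VIII.4), (VIII.5)
  follow; typed as predicates in `…MRS93SlavnovHierarchy`).
* p.378 [PDF 54] tl.2–4: *«For a theory with a fixed infrared-cutoff of a given type, the linear term in γ for a gauge
  transformation A → A + Dγ receives a contribution from the presence in (VIII.1) of the cutoff. This leads to correction
  terms in the Slavnov identities.»* ((VIII.6) with `E_N`; typed as `MainStatement.SlavnovPrinted`).
* Sect. II.A, used here: p.328 tl.27–28 *«the covariant derivative is D_μ = ∂_μ − λ[A_μ, ·]»*; tl.32–33 *«the commutator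
  is a wedge product»*; tl.34–35 (II.2) *«¼∫Σ_a F^a_μν F^μν_a»*; p.329 tl.10–11 (II.5) *«(A^γ)_μ = A_μ + D_μγ»*; tl.20–21
  (II.7) *«Our starting point is the Yang–Mills theory in the axial gauge. This gauge is defined by the condition A₀ = 0»*;
  tl.29–32 *«there remains a subgroup of the gauge group which acts still on the configurations satisfying (II.7), namely
  the gauge transformations independent of x⁰ … We do not fix this remaining invariance yet.»*

**What is typed here (definitions with bodies; everything stated is PROVED; zero `sorry`; zero named facts).**
* §1 READING (FD) — «the formal Lebesgue measure» and «no first order dependence in γ» of the MEASURE. On a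
  finite-dimensional field space `ι → ℝ` with Lebesgue measure: `affineField M v` (`V(A) = M·A + v`, the shape of
  `A ↦ Dγ = ∂γ + λ[γ, A]`: affine in `A`); **`integral_fderiv_affineField_eq_zero`**: if `trace M = 0` (unit Jacobian to
  first order) then `∫ dH_A[V(A)] dA = 0` for every differentiable `H` with `H`, `A_j·H`, `V_i·∂_iH` integrable —
  Mathlib's integration by parts for line derivatives (`integral_bilinear_hasFDerivAt_right_eq_neg_left_of_integrable`)
  coordinate by coordinate, summed against `trace M = 0`; `formalExpect S G = ∫ G e^{−S} dA` (the unnormalised «⟨·⟩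
  with respect to the formal Lebesgue measure» with action `S`; the gauge condition `δ(A₀)` is READING (AX0): the domain
  holds no `A₀` coordinates, as in (II.7)–(II.10)); **`formalExpect_fderiv_eq`**: `⟨dG[V]⟩_S = ⟨G·dS[V]⟩_S`;
  `formalExpect_ward_vacuum` (v1.1): the source-free member `⟨dS[V]⟩_S = 0` (`N = 1`);
  **`formalExpect_ward_generating`** — THE SHAPE OF (VIII.2)/(VIII.3): `⟨(J·V(A) − dS_A[V(A)]) e^{J·A}⟩_S = 0` for every
  source `J`; **`formalExpect_ward_monomial`** — THE SHAPE OF THE HIERARCHY (VIII.4)/(VIII.5) («any number N of external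
  sources»): `⟨Σ_k (Π_{j≠k} A_{c_j})·V(A)_{c_k}⟩_S = ⟨(Π_j A_{c_j})·dS_A[V(A)]⟩_S` — the coefficient of `J_{c_1}⋯J_{c_{N−1}}`,
  with no functional derivative needed in finite dimensions; **`formalExpect_ward_generating_correction`** — THE SHAPE OF
  (VIII.6) (p.378 tl.2–4 «the linear term in γ … receives a contribution from the presence in (VIII.1) of the cutoff. This
  leads to correction terms»): with the exponent split `S = S₁ + S₂`, `⟨(J·V − dS₁[V]) e^{J·A}⟩_{S₁+S₂} = ⟨dS₂[V] e^{J·A}⟩_{S₁+S₂}`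
  (what MRS put into `S₂`, and `E_N`, are not typed); `eq_zero_of_formalExpect_mul_self_eq_zero` (an insertion `X` with
  `⟨X·X⟩_S = 0`, `X`, `S` continuous, vanishes identically). All integrability hypotheses are explicit binders.
* §2 the Jacobian of «A → A + Dγ» to first order: on finitely many sites `X` (READING (FD-sites)) the linear part
  `A ↦ λ[γ, A]` is the matrix `gaugeMatrix lam γ` on `X × Fin 3`; `gaugeMatrix_mulVec` (it IS `λ[γ(x), A(x)]` sitewise, with
  the tree's printed bracket) and **`trace_gaugeMatrix`** (`= 0`: `ε_{aba} = 0`) — the divergence-freeness §1 consumes.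
* §3 READING (J) — THE (VIII.2) DENSITY FROM THE AXIAL ACTION. `IsAxialJet` (`A₀ ≡ 0` at the point: value and first
  derivatives), `axialLine lam A γ t` (the change of variables on the axial field: `A_m ↦ A_m + tD_mγ` for `m = 1,2,3`, `A₀`
  untouched — it stays axial, `axialLine_isAxial`), `covDTime` (`D_m∂₀γ = ∂_m∂₀γ − λ[A_m, ∂₀γ]`), `opVIII2` (the displayed
  `[∂/∂x⁰ A^a_m · D^{ab}_m] ∂/∂x⁰` applied to `γ^b`: `Σ_m ∂₀A^a_m (D_m∂₀γ)^a`), `srcTerm` (`J^a_m D^{ab}_m γ^b = J^a_m(D_mγ)^a`),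
  `pairing` (`J·A`); **`fieldStrengthSq_axialLine`** (closed form: `Σ(F(A + tDγ|_spatial))² = S₀ + 4t·opVIII2 + t²·C(t)`, the
  magnetic pairs by `…InfinitesimalGauge.sum_sq_curvature_gaugeLine` — no linear term —, the electric pairs by
  `∂₀A_m·[∂₀A_m, γ] = 0`); **`hasDerivAt_quarter_fieldStrengthSq_axialLine`**: `d/dt|₀ ¼Σ(F(A + tDγ))² = Σ_m ∂₀A^a_m(D_m∂₀γ)^a`;
  **`hasDerivAt_exponent_axialLine`**: the exponent `−F²/4 + J·A` of (VIII.1) has first-order coefficient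
  `J^a_m(D_mγ)^a − ∂₀A^a_m(D_m∂₀γ)^a` — the bracket of (VIII.2) EXACTLY AS DISPLAYED (both signs, no factor).
* §4 THE STEP (VIII.2) → (VIII.3). **`opVIII2_eq`** (exact, every jet): `Σ_m ∂₀A_m·D_m∂₀γ = Σ_m ∂₀A_m·∂_m∂₀γ +
  λΣ_m [A_m, ∂₀A_m]·∂₀γ` (`leadVIII3 + residual`; scalar triple product); `dot_covDTime_eq` (the quoted fact, for `∂₀γ`:
  `A_m·D_m∂₀γ = A_m·∂_m∂₀γ`); `opVIII3` (the displayed (VIII.3) operator `[∂/∂x^m A^b_m](∂/∂x⁰)²` applied to `γ^b`). The lead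
  term `∂₀A_m·∂_m∂₀γ` is the printed `(∂_mA_m)·∂₀²γ` modulo two integrations by parts (in `x⁰` and `x^m`; total
  derivatives are not expressible on 1-jets of `A`, so this is said, not typed); the residual is what «A_mD_m = A_m∂_m»
  would remove if the factor standing left of `D_m` were `A_m` — after the change of variables it is `∂₀A_m`.
  `IsStaticJet` (`γ` independent of `x⁰` at the point — the residual invariance «the gauge transformations independent of
  x⁰ … We do not fix this remaining invariance yet», p.329 tl.29–32): `opVIII2_eq_zero_of_static`, `residual_eq_zero_of_static`,
  `opVIII3_eq_zero_of_static` — for such `γ` both displays reduce to `⟨J·Dγ e^{J·A}⟩ = 0`; what follows concerns only the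
  `x⁰`-dependence of `γ`. **PRECISION (s), kernel-exhibited, READING (1D).** `wA t`, `wγ t` = the jets at a point with `x⁰ = t` of the smooth
  `2π`-periodic, `x⃗`-INDEPENDENT configuration `A₁ = t₁ + sin x⁰·t₂`, `A₂ = A₃ = A₀ = 0`, `γ = sin x⁰·t₃` (colour basis
  `t₁,t₂,t₃`): `wA_isAxial`, `wγ_symm`; `opVIII2_witness` (`= λcos²x⁰`), `leadVIII3_witness` (`= 0`), `residual_witness`
  (`= λcos²x⁰`), `opVIII3_witness` (`= 0`); over one period — where «integrating by parts» in `x⁰` has no boundary term and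
  nothing depends on `x⃗` — **`integral_opVIII2_witness`** (`∫₀^{2π} = λπ`) versus **`integral_opVIII3_witness`** (`= 0`), and
  `integral_opVIII2_ne_opVIII3_witness` (`λ ≠ 0`). So the two displayed operators, applied to this `γ` and integrated over
  `x`, differ by `λπ·vol` on this `A`: as functionals of `A` the integrands of (VIII.2) and (VIII.3) differ by
  `X_γ(A) = λ∫⟨[A_m, ∂₀A_m], ∂₀γ⟩`, which is not identically zero; (VIII.3) follows from (VIII.2) exactly when in addition
  `⟨X_γ(A) e^{J·A}⟩_ax = 0`, an identity the print does not state (the sentence tl.26 covers `A_m·[A_m, ·] = 0`); and in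
  any (FD) model in which BOTH hierarchies (the (VIII.2)-form and the (VIII.3)-form) held for every `N`, the polynomial
  insertion `X_γ` would satisfy `⟨X_γ·p⟩ = 0` for every polynomial `p`, hence `⟨X_γ²⟩ = 0`, hence `X_γ ≡ 0`
  (`eq_zero_of_formalExpect_mul_self_eq_zero`) — which the witness excludes for `λ ≠ 0`.
  NOT ADJUDICATED: Sect. VIII is formal by its own word («Formally», tl.15) and a self-declared sketch (p.378 tl.25);
  whether the residual is intended to be absorbed elsewhere is not printed; no tree statement depends on it (the
  hierarchy (VIII.4)–(VIII.6) is typed on an abstract functional `MainStatement.AxialTheory.wardLHS`). Recorded beside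
  the earlier as-printed precisions (k) (p.341 tl.20, referee-confirmed), (l) ((II.63)), (m)–(r) in the companion record §5.

**Readings (declared).** (FD) finite-dimensional field space with Lebesgue measure for «the formal Lebesgue measure»;
the action `S` and the observables are arbitrary differentiable functions with the stated integrability — the genuine
`(II.78)` integrand is NOT instantiated (MRS's cut-off measure is not a finite-dimensional Lebesgue density with these
properties by anything printed). (AX0) `δ(A₀)` = no `A₀` coordinates (the axial field has three components, (II.7)–(II.10)).
(J) jets: §3–§4 are identities of the values of `A, ∂A, γ, ∂γ, ∂∂γ` at one point (as in `…InfinitesimalGauge`); the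
passage density ↦ `∫_Λ dx` and the identification `dS_A[Dγ] = ∫_Λ opVIII2` are the standard ones for smooth fields on the
torus and are NOT typed (no position-space field, torus or `x`-integral is built here; READING (1D) integrates the one
variable the witness depends on). (T) the wedge-product sign is the print's (`TruncatedGauge.bracket`). (SP) in Sect.
VIII the index `m` of `J_m`, `A_m`, `D_m` is spatial, `m ∈ {1,2,3}` (axial gauge): typed as `Fin.succ i`, `i : Fin 3`.

**Honest status / what is NOT claimed.** No expectation `⟨·⟩_ax` of MRS's theory is constructed; (VIII.1)'s second
equality (the constructed axial-gauge expectation equals the formal one) is MRS's construction claim and is not touched;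
`E_N`, `δ_N(ρ)`, the approximate identities and their `ρ → ∞` limit (p.378 tl.13–24) stay `…MRS93MainStatement`'s
predicates; the FINITE gauge invariance (II.4) and the exact Faddeev–Popov triviality «there is no Fadeev–Popov
determinant in the axial gauge» (p.330 tl.3–5) are quoted, not typed (only the first-order = traceless statement §2).
Precision (s) is a statement about two displayed integrands, not about MRS's theorem. Nothing here bears on Bałaban's
papers; nothing is continuum YM₄ on `T⁴`, nothing lifts the infrared cutoff, nothing is Clay.
-/

noncomputable section

namespace Literature.MathematicalPhysics.QuantumFieldTheory.MagnenRivasseauSeneor1993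

namespace AxialWard

open _root_.MeasureTheory InfinitesimalGauge SectIV TruncatedGauge

/-! ## §1 READING (FD): «the formal Lebesgue measure» — a divergence-free affine change of variables has no first-order
effect; the shape of (VIII.2)/(VIII.3) and of the hierarchy -/

section FormalLebesgue

variable {ι : Type*} [Fintype ι]

/-- An AFFINE vector field `V(A) = M·A + v` on the finite-dimensional field space `ι → ℝ` — the shape of the
infinitesimal gauge transformation `A ↦ Dγ = ∂γ − λ[A, γ] = ∂γ + λ[γ, A]` of (II.5)/(VIII.2) at fixed `γ` (constant part
`∂γ`, linear part `λ[γ, ·]`). READING (FD). [cite: MagnenRivasseauSeneor1993, (II.5) p.329 tl.10–11, (VIII.2) p.377 tl.22] -/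
def affineField (M : Matrix ι ι ℝ) (v : ι → ℝ) (A : ι → ℝ) : ι → ℝ := M.mulVec A + v

/-- The linear part of the `i`-th component of `affineField M v`, as a continuous linear map (`A ↦ Σ_j M_ij A_j`).
[cite: MagnenRivasseauSeneor1993, (VIII.2) p.377 tl.22] -/
def rowCLM (M : Matrix ι ι ℝ) (i : ι) : (ι → ℝ) →L[ℝ] ℝ :=
  ∑ j, M i j • ContinuousLinearMap.proj j

/-- `rowCLM M i A = Σ_j M_ij A_j`. [cite: MagnenRivasseauSeneor1993, (VIII.2) p.377 tl.22] -/
theorem rowCLM_apply (M : Matrix ι ι ℝ) (i : ι) (A : ι → ℝ) : rowCLM M i A = ∑ j, M i j * A j := by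
  simp [rowCLM]

/-- Components of the affine field: `V(A)_i = Σ_j M_ij A_j + v_i`. [cite: MagnenRivasseauSeneor1993, (VIII.2) p.377 tl.22] -/
theorem affineField_apply (M : Matrix ι ι ℝ) (v : ι → ℝ) (A : ι → ℝ) (i : ι) :
    affineField M v A i = ∑ j, M i j * A j + v i := by
  simp [affineField, Matrix.mulVec, dotProduct]

/-- Each component of the affine field is differentiable with CONSTANT derivative `rowCLM M i`.
[cite: MagnenRivasseauSeneor1993, (VIII.2) p.377 tl.22] -/
theorem hasFDerivAt_affineField (M : Matrix ι ι ℝ) (v : ι → ℝ) (i : ι) (A : ι → ℝ) :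
    HasFDerivAt (fun B => affineField M v B i) (rowCLM M i) A := by
  have h : (fun B => affineField M v B i) = fun B => rowCLM M i B + v i := by
    funext B; rw [affineField_apply, rowCLM_apply]
  rw [h]
  exact (rowCLM M i).hasFDerivAt.add_const (v i)

/-- If `H` and every `A_j·H` are integrable then so is `V(A)_i·H`. [cite: MagnenRivasseauSeneor1993, (VIII.1)–(VIII.2) p.377] -/
theorem integrable_affineField_mul (M : Matrix ι ι ℝ) (v : ι → ℝ) (i : ι) {H : (ι → ℝ) → ℝ}
    (hint : Integrable H) (hintA : ∀ j, Integrable (fun A => A j * H A)) :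
    Integrable (fun A => affineField M v A i * H A) := by
  have h : (fun A => affineField M v A i * H A) = fun A => (∑ j, M i j * (A j * H A)) + v i * H A := by
    funext A; rw [affineField_apply]; rw [add_mul, Finset.sum_mul]; simp [mul_assoc]
  rw [h]
  exact (integrable_finsetSum _ fun j _ => (hintA j).const_mul _).add (hint.const_mul _)

variable [DecidableEq ι]

/-- The diagonal entry: `∂_i V(A)_i = M_ii`. [cite: MagnenRivasseauSeneor1993, (VIII.2) p.377 tl.22] -/
theorem rowCLM_single (M : Matrix ι ι ℝ) (i : ι) : rowCLM M i (Pi.single i 1) = M i i := by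
  rw [rowCLM_apply]
  simp [Pi.single_apply]

/-- A linear functional contracted with a vector is the sum of its coordinate values weighted by the vector's
components: `L(w) = Σ_i w_i L(e_i)`. [cite: MagnenRivasseauSeneor1993, (VIII.2) p.377] -/
theorem clm_apply_eq_sum (L : (ι → ℝ) →L[ℝ] ℝ) (w : ι → ℝ) :
    L w = ∑ i, w i * L (Pi.single i 1) := by
  conv_lhs => rw [show w = ∑ i, w i • (Pi.single i (1 : ℝ) : ι → ℝ) from by
    funext j; simp [Finset.sum_apply, Pi.single_apply]]
  rw [map_sum]
  simp [smul_eq_mul]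

/-- **«BY (INFINITESIMAL) GAUGE INVARIANCE, THERE IS NO FIRST ORDER DEPENDENCE IN γ» — THE MEASURE SIDE, READING (FD).**
For an affine vector field `V(A) = M·A + v` with `trace M = 0` (the Jacobian of `A ↦ A + tV(A)` is `1 + O(t²)`) and a
differentiable density `H` on the finite-dimensional field space with `H`, `A_j·H` and `V_i·∂_iH` integrable:
`∫ dH_A[V(A)] dA = 0` — i.e. `d/dt|₀ ∫ H(A + tV(A)) dA = 0` for «the formal Lebesgue measure» (p.377 tl.18). Proof:
coordinatewise integration by parts `∫ V_i ∂_iH = −∫ (∂_iV_i) H = −M_ii ∫H` (Mathlib, line derivatives on a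
finite-dimensional space with an additive Haar measure), summed: `−trace(M)·∫H = 0`.
[cite: MagnenRivasseauSeneor1993, §VIII (VIII.1)–(VIII.2) p.377 tl.18–23] -/
theorem integral_fderiv_affineField_eq_zero (M : Matrix ι ι ℝ) (v : ι → ℝ) (hM : M.trace = 0)
    {H : (ι → ℝ) → ℝ} {H' : (ι → ℝ) → ((ι → ℝ) →L[ℝ] ℝ)} (hH : ∀ A, HasFDerivAt H (H' A) A)
    (hint : Integrable H) (hintA : ∀ j, Integrable (fun A => A j * H A))
    (hintV : ∀ i, Integrable (fun A => affineField M v A i * H' A (Pi.single i 1))) :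
    ∫ A, H' A (affineField M v A) = 0 := by
  have hexp : ∀ A, H' A (affineField M v A) = ∑ i, affineField M v A i * H' A (Pi.single i 1) :=
    fun A => clm_apply_eq_sum (H' A) _
  simp_rw [hexp]
  rw [integral_finsetSum _ (fun i _ => hintV i)]
  have hterm : ∀ i, ∫ A, affineField M v A i * H' A (Pi.single i 1) = -(M i i * ∫ A, H A) := by
    intro i
    have h := integral_bilinear_hasFDerivAt_right_eq_neg_left_of_integrable (μ := (volume : Measure (ι → ℝ)))
      (B := ContinuousLinearMap.mul ℝ ℝ) (f := fun B => affineField M v B i) (f' := fun _ => rowCLM M i)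
      (g := H) (g' := H') (v := Pi.single i 1) ?_ ?_ ?_ (fun A _ => hasFDerivAt_affineField M v i A)
      (fun A _ => hH A)
    · simpa [rowCLM_single, integral_const_mul] using h
    · simpa [rowCLM_single] using hint.const_mul (M i i)
    · simpa using hintV i
    · simpa using integrable_affineField_mul M v i hint hintA
  simp_rw [hterm]
  rw [Finset.sum_neg_distrib, ← Finset.sum_mul]
  have : ∑ i, M i i = M.trace := by simp [Matrix.trace]
  rw [this, hM]
  simp

/-- **(VIII.1), READING (FD)/(AX0): «the first expectation value is with respect to the formal Lebesgue measure»** —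
the UNNORMALISED formal expectation with action `S` on the finite-dimensional field space, `⟨G⟩_S = ∫ G(A) e^{−S(A)} dA`;
in (VIII.1) `S = F²/4` restricted to `A₀ = 0` (the `δ(A₀)` is realised by the domain holding no `A₀` coordinates) and
`G = e^{J·A}` gives `W(J)`. The print's second expectation `⟨·⟩_ax` («constructed by the limit process») is NOT this
object and is not constructed here; normalisation does not affect the `= 0` identities below.
[cite: MagnenRivasseauSeneor1993, §VIII (VIII.1) p.377 tl.14–21] -/
def formalExpect (S G : (ι → ℝ) → ℝ) : ℝ := ∫ A, G A * Real.exp (-S A)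

/-- Bookkeeping: coordinatewise integrability of `V_i·K(e_i)·w` gives integrability of the contracted `K(V)·w`.
[cite: MagnenRivasseauSeneor1993, (VIII.2) p.377] -/
theorem integrable_sum_affineField_mul (M : Matrix ι ι ℝ) (v : ι → ℝ) {K : (ι → ℝ) → ((ι → ℝ) →L[ℝ] ℝ)}
    {w : (ι → ℝ) → ℝ} (h : ∀ i, Integrable (fun A => affineField M v A i * (K A (Pi.single i 1) * w A))) :
    Integrable (fun A => K A (affineField M v A) * w A) := by
  have : (fun A => K A (affineField M v A) * w A) =
      fun A => ∑ i, affineField M v A i * (K A (Pi.single i 1) * w A) := by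
    funext A; rw [clm_apply_eq_sum (K A) (affineField M v A), Finset.sum_mul]
    exact Finset.sum_congr rfl fun i _ => by ring
  rw [this]
  exact integrable_finsetSum _ fun i _ => h i

/-- **The change of variables `A → A + V(A)` inside `⟨G⟩_S`, to first order: `⟨dG[V]⟩_S = ⟨G·dS[V]⟩_S`** for a
divergence-free affine `V` (READING (FD); integrability hypotheses explicit) — `integral_fderiv_affineField_eq_zero`
for the density `H = G·e^{−S}`, whose derivative is `(dG − G·dS)e^{−S}`.
[cite: MagnenRivasseauSeneor1993, §VIII (VIII.1)–(VIII.2) p.377 tl.18–25] -/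
theorem formalExpect_fderiv_eq (M : Matrix ι ι ℝ) (v : ι → ℝ) (hM : M.trace = 0)
    {S G : (ι → ℝ) → ℝ} {S' G' : (ι → ℝ) → ((ι → ℝ) →L[ℝ] ℝ)}
    (hS : ∀ A, HasFDerivAt S (S' A) A) (hG : ∀ A, HasFDerivAt G (G' A) A)
    (hint : Integrable (fun A => G A * Real.exp (-S A)))
    (hintA : ∀ j, Integrable (fun A => A j * (G A * Real.exp (-S A))))
    (hintG' : ∀ i, Integrable (fun A => affineField M v A i * (G' A (Pi.single i 1) * Real.exp (-S A))))
    (hintS' : ∀ i, Integrable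
      (fun A => affineField M v A i * (S' A (Pi.single i 1) * (G A * Real.exp (-S A))))) :
    formalExpect S (fun A => G' A (affineField M v A)) =
      formalExpect S (fun A => G A * S' A (affineField M v A)) := by
  set H : (ι → ℝ) → ℝ := fun A => G A * Real.exp (-S A) with hHdef
  set H' : (ι → ℝ) → ((ι → ℝ) →L[ℝ] ℝ) :=
    fun A => Real.exp (-S A) • G' A - (G A * Real.exp (-S A)) • S' A with hH'def
  have hH : ∀ A, HasFDerivAt H (H' A) A := by
    intro A
    have he : HasFDerivAt (fun B => Real.exp (-S B)) (Real.exp (-S A) • (-S' A)) A := (hS A).neg.exp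
    have h := (hG A).mul he
    refine h.congr_fderiv ?_
    simp only [H']
    ext w
    simp only [add_apply, smul_apply, neg_apply, sub_apply, smul_eq_mul]
    ring
  have h0 := integral_fderiv_affineField_eq_zero M v hM hH hint hintA ?_
  · have hsplit : ∀ A, H' A (affineField M v A) =
        G' A (affineField M v A) * Real.exp (-S A) - (G A * S' A (affineField M v A)) * Real.exp (-S A) := by
      intro A
      simp only [H', sub_apply, smul_apply, smul_eq_mul]
      ring
    simp_rw [hsplit] at h0
    have hi1 : Integrable (fun A => G' A (affineField M v A) * Real.exp (-S A)) :=
      integrable_sum_affineField_mul M v hintG'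
    have hi2 : Integrable (fun A => (G A * S' A (affineField M v A)) * Real.exp (-S A)) := by
      have := integrable_sum_affineField_mul M v (K := S') (w := fun A => G A * Real.exp (-S A)) hintS'
      refine this.congr (Filter.Eventually.of_forall fun A => ?_)
      simp only
      ring
    rw [integral_sub hi1 hi2, sub_eq_zero] at h0
    simpa [formalExpect] using h0
  · intro i
    have h1 := hintG' i
    have h2 := hintS' i
    refine ((h1.sub h2).congr (Filter.Eventually.of_forall fun A => ?_))
    simp only [H', Pi.sub_apply, sub_apply, smul_apply, smul_eq_mul]
    ring

/-- **The source-free member (`N = 1`, `J = 0`) of the hierarchy, READING (FD): `⟨dS_A[V(A)]⟩_S = 0`** for a divergence-free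
affine `V` — in print the `N = 1` case of (VIII.5)/(VIII.6) (no field points `x_j`, only `y`): `⟨[∂/∂y^n A^b_n(y)](∂/∂y⁰)²⟩_ax = 0`
formally. `formalExpect_fderiv_eq` with the constant observable `G = 1`. (Edition v1.1.)
[cite: MagnenRivasseauSeneor1993, §VIII (VIII.2)–(VIII.5) p.377 tl.22–39] -/
theorem formalExpect_ward_vacuum (M : Matrix ι ι ℝ) (v : ι → ℝ) (hM : M.trace = 0)
    {S : (ι → ℝ) → ℝ} {S' : (ι → ℝ) → ((ι → ℝ) →L[ℝ] ℝ)} (hS : ∀ A, HasFDerivAt S (S' A) A)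
    (hint : Integrable (fun A => Real.exp (-S A)))
    (hintA : ∀ j, Integrable (fun A => A j * Real.exp (-S A)))
    (hintS' : ∀ i, Integrable (fun A => affineField M v A i * (S' A (Pi.single i 1) * Real.exp (-S A)))) :
    formalExpect S (fun A => S' A (affineField M v A)) = 0 := by
  have hG : ∀ A : ι → ℝ, HasFDerivAt (fun _ : ι → ℝ => (1 : ℝ)) (0 : (ι → ℝ) →L[ℝ] ℝ) A :=
    fun A => hasFDerivAt_const 1 A
  have h := formalExpect_fderiv_eq M v hM hS hG (by simpa using hint) (by simpa using hintA)
    (fun i => by simp) (by simpa using hintS')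
  simpa [formalExpect] using h.symm

/-- **THE SHAPE OF (VIII.2)/(VIII.3), READING (FD): `⟨(J·V(A) − dS_A[V(A)]) e^{J·A}⟩_S = 0`** for every source `J`,
every differentiable action `S` and every divergence-free affine `V` (the observable `G = e^{J·A}` of (VIII.1) has
`dG[V] = (J·V)e^{J·A}`). With `V = Dγ` and `S = F²/4|_{A₀=0}` the two terms are the displayed `J^a_m D^{ab}_m γ^b` and (by
§3) `∂₀A^a_m D^{ab}_m ∂₀γ^b`, integrated over `x`. Integrability hypotheses explicit; nothing of `⟨·⟩_ax`.
[cite: MagnenRivasseauSeneor1993, §VIII (VIII.1)–(VIII.3) p.377 tl.14–27] -/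
theorem formalExpect_ward_generating (M : Matrix ι ι ℝ) (v : ι → ℝ) (hM : M.trace = 0)
    {S : (ι → ℝ) → ℝ} {S' : (ι → ℝ) → ((ι → ℝ) →L[ℝ] ℝ)} (hS : ∀ A, HasFDerivAt S (S' A) A) (J : ι → ℝ)
    (hint : Integrable (fun A => Real.exp (J ⬝ᵥ A) * Real.exp (-S A)))
    (hintA : ∀ j, Integrable (fun A => A j * (Real.exp (J ⬝ᵥ A) * Real.exp (-S A))))
    (hintG' : ∀ i, Integrable
      (fun A => affineField M v A i * (Real.exp (J ⬝ᵥ A) * J i * Real.exp (-S A))))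
    (hintS' : ∀ i, Integrable
      (fun A => affineField M v A i * (S' A (Pi.single i 1) * (Real.exp (J ⬝ᵥ A) * Real.exp (-S A))))) :
    formalExpect S (fun A => (J ⬝ᵥ affineField M v A - S' A (affineField M v A)) * Real.exp (J ⬝ᵥ A)) = 0 := by
  let Jclm : (ι → ℝ) →L[ℝ] ℝ := ∑ j, J j • ContinuousLinearMap.proj j
  have hJclm : ∀ w, Jclm w = J ⬝ᵥ w := fun w => by simp [Jclm, dotProduct]
  have hG : ∀ A, HasFDerivAt (fun B => Real.exp (J ⬝ᵥ B)) (Real.exp (J ⬝ᵥ A) • Jclm) A := by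
    intro A
    have hlin : HasFDerivAt (fun B => J ⬝ᵥ B) Jclm A := by
      have := Jclm.hasFDerivAt (x := A)
      refine this.congr_of_eventuallyEq (Filter.Eventually.of_forall fun B => (hJclm B).symm) |>.congr_fderiv rfl
    exact hlin.exp
  have h := formalExpect_fderiv_eq M v hM hS hG hint hintA ?_ ?_
  · have h2 : formalExpect S (fun A => (J ⬝ᵥ affineField M v A - S' A (affineField M v A)) * Real.exp (J ⬝ᵥ A)) =
        formalExpect S (fun A => (Real.exp (J ⬝ᵥ A) • Jclm) (affineField M v A)) -
          formalExpect S (fun A => Real.exp (J ⬝ᵥ A) * S' A (affineField M v A)) := by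
      simp only [formalExpect]
      rw [← integral_sub]
      · refine integral_congr_ae (Filter.Eventually.of_forall fun A => ?_)
        simp only [smul_apply, hJclm, smul_eq_mul]
        ring
      · have := integrable_sum_affineField_mul M v (K := fun A => Real.exp (J ⬝ᵥ A) • Jclm)
          (w := fun A => Real.exp (-S A)) ?_
        · simpa using this
        · intro i
          refine (hintG' i).congr (Filter.Eventually.of_forall fun A => ?_)
          simp only [smul_apply, hJclm, smul_eq_mul]
          simp [dotProduct, Pi.single_apply]
      · have := integrable_sum_affineField_mul M v (K := S')
          (w := fun A => Real.exp (J ⬝ᵥ A) * Real.exp (-S A)) hintS'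
        refine this.congr (Filter.Eventually.of_forall fun A => ?_)
        simp only
        ring
    rw [h2, h, sub_self]
  · intro i
    refine (hintG' i).congr (Filter.Eventually.of_forall fun A => ?_)
    simp only [smul_apply, hJclm, smul_eq_mul]
    simp [dotProduct, Pi.single_apply]
  · exact hintS'

/-- **p.378 tl.2–4, READING (FD): «the linear term in γ for a gauge transformation A → A + Dγ receives a contribution from
the presence in (VIII.1) of the cutoff. This leads to correction terms in the Slavnov identities»** — with the action split
as `S = S₁ + S₂` (`S₂` standing for whatever non-invariant terms the cutoffs put into the exponent of (VIII.1)), the Ward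
equation written for `S₁` alone acquires the right-hand side `⟨dS₂[V]·e^{J·A}⟩`:
`⟨(J·V(A) − dS₁[V](A)) e^{J·A}⟩_{S₁+S₂} = ⟨dS₂[V](A) e^{J·A}⟩_{S₁+S₂}` — the SHAPE of (VIII.6) `… = E_N`. Nothing is said
about which terms MRS put in `S₂`, nor is `E_N` computed. [cite: MagnenRivasseauSeneor1993, §VIII (VIII.6) p.378 tl.2–9] -/
theorem formalExpect_ward_generating_correction (M : Matrix ι ι ℝ) (v : ι → ℝ) (hM : M.trace = 0)
    {S₁ S₂ : (ι → ℝ) → ℝ} {S₁' S₂' : (ι → ℝ) → ((ι → ℝ) →L[ℝ] ℝ)} (hS₁ : ∀ A, HasFDerivAt S₁ (S₁' A) A)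
    (hS₂ : ∀ A, HasFDerivAt S₂ (S₂' A) A) (J : ι → ℝ)
    (hint : Integrable (fun A => Real.exp (J ⬝ᵥ A) * Real.exp (-(S₁ A + S₂ A))))
    (hintA : ∀ j, Integrable (fun A => A j * (Real.exp (J ⬝ᵥ A) * Real.exp (-(S₁ A + S₂ A)))))
    (hintG' : ∀ i, Integrable
      (fun A => affineField M v A i * (Real.exp (J ⬝ᵥ A) * J i * Real.exp (-(S₁ A + S₂ A)))))
    (hintS₁' : ∀ i, Integrable (fun A => affineField M v A i *
      (S₁' A (Pi.single i 1) * (Real.exp (J ⬝ᵥ A) * Real.exp (-(S₁ A + S₂ A))))))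
    (hintS₂' : ∀ i, Integrable (fun A => affineField M v A i *
      (S₂' A (Pi.single i 1) * (Real.exp (J ⬝ᵥ A) * Real.exp (-(S₁ A + S₂ A)))))) :
    formalExpect (fun A => S₁ A + S₂ A)
        (fun A => (J ⬝ᵥ affineField M v A - S₁' A (affineField M v A)) * Real.exp (J ⬝ᵥ A)) =
      formalExpect (fun A => S₁ A + S₂ A) (fun A => S₂' A (affineField M v A) * Real.exp (J ⬝ᵥ A)) := by
  have hS : ∀ A, HasFDerivAt (fun B => S₁ B + S₂ B) (S₁' A + S₂' A) A := fun A => (hS₁ A).add (hS₂ A)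
  have hintS' : ∀ i, Integrable (fun A => affineField M v A i *
      ((S₁' A + S₂' A) (Pi.single i 1) * (Real.exp (J ⬝ᵥ A) * Real.exp (-(S₁ A + S₂ A))))) := by
    intro i
    refine ((hintS₁' i).add (hintS₂' i)).congr (Filter.Eventually.of_forall fun A => ?_)
    simp only [Pi.add_apply, add_apply]
    ring
  have h0 := formalExpect_ward_generating M v hM hS J hint hintA hintG' hintS'
  -- split `⟨(J·V − S₁'(V) − S₂'(V)) e^{J·A}⟩ = 0`
  have hi2 : Integrable (fun A => S₂' A (affineField M v A) * Real.exp (J ⬝ᵥ A) *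
      Real.exp (-(S₁ A + S₂ A))) := by
    have := integrable_sum_affineField_mul M v (K := S₂')
      (w := fun A => Real.exp (J ⬝ᵥ A) * Real.exp (-(S₁ A + S₂ A))) hintS₂'
    refine this.congr (Filter.Eventually.of_forall fun A => ?_)
    simp only
    ring
  have hi1 : Integrable (fun A => S₁' A (affineField M v A) * Real.exp (J ⬝ᵥ A) *
      Real.exp (-(S₁ A + S₂ A))) := by
    have := integrable_sum_affineField_mul M v (K := S₁')
      (w := fun A => Real.exp (J ⬝ᵥ A) * Real.exp (-(S₁ A + S₂ A))) hintS₁'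
    refine this.congr (Filter.Eventually.of_forall fun A => ?_)
    simp only
    ring
  have hiJ : Integrable (fun A => (J ⬝ᵥ affineField M v A) * Real.exp (J ⬝ᵥ A) *
      Real.exp (-(S₁ A + S₂ A))) := by
    let Jclm : (ι → ℝ) →L[ℝ] ℝ := ∑ j, J j • ContinuousLinearMap.proj j
    have hJclm : ∀ w, Jclm w = J ⬝ᵥ w := fun w => by simp [Jclm, dotProduct]
    have := integrable_sum_affineField_mul M v (K := fun _ => Jclm)
      (w := fun A => Real.exp (J ⬝ᵥ A) * Real.exp (-(S₁ A + S₂ A))) ?_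
    · refine this.congr (Filter.Eventually.of_forall fun A => ?_)
      simp only [hJclm]
      ring
    · intro i
      refine (hintG' i).congr (Filter.Eventually.of_forall fun A => ?_)
      have hJi : J ⬝ᵥ Pi.single i 1 = J i := by simp [dotProduct, Pi.single_apply]
      simp only [hJclm, hJi]
      ring
  have hsplit : formalExpect (fun A => S₁ A + S₂ A)
      (fun A => (J ⬝ᵥ affineField M v A - (S₁' A + S₂' A) (affineField M v A)) * Real.exp (J ⬝ᵥ A)) =
      formalExpect (fun A => S₁ A + S₂ A)
        (fun A => (J ⬝ᵥ affineField M v A - S₁' A (affineField M v A)) * Real.exp (J ⬝ᵥ A)) -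
      formalExpect (fun A => S₁ A + S₂ A) (fun A => S₂' A (affineField M v A) * Real.exp (J ⬝ᵥ A)) := by
    simp only [formalExpect]
    rw [← integral_sub]
    · refine integral_congr_ae (Filter.Eventually.of_forall fun A => ?_)
      simp only [add_apply]
      ring
    · refine (hiJ.sub hi1).congr (Filter.Eventually.of_forall fun A => ?_)
      simp only [Pi.sub_apply]
      ring
    · exact hi2.congr (Filter.Eventually.of_forall fun A => by ring)
  rw [hsplit, sub_eq_zero] at h0
  exact h0

/-- **THE SHAPE OF THE HIERARCHY (VIII.4)/(VIII.5), READING (FD): monomial observables** — «This identity gives rise to a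
hierarchy of identities with any number N of external sources» (tl.28–29): for indices `c_1, …, c_n` (the `N − 1 = n`
field points) `⟨Σ_k (Π_{j≠k} A_{c_j})·V(A)_{c_k}⟩_S = ⟨(Π_j A_{c_j})·dS_A[V(A)]⟩_S` — in print the first sum is
`Σ_i (Π_{j≠i} A^{a_j}_{m_j}(x_j)) D^{a_ib}_{m_i}δ(x_i − y)` and the right side the `[…](∂/∂y⁰)²` term of (VIII.5) moved across.
In finite dimensions this is `formalExpect_fderiv_eq` for `G = Π_j A_{c_j}` (product rule), no functional derivative
`δ/δJ` being needed. Integrability hypotheses explicit. [cite: MagnenRivasseauSeneor1993, §VIII (VIII.3)–(VIII.5) p.377 tl.26–39] -/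
theorem formalExpect_ward_monomial (M : Matrix ι ι ℝ) (v : ι → ℝ) (hM : M.trace = 0)
    {S : (ι → ℝ) → ℝ} {S' : (ι → ℝ) → ((ι → ℝ) →L[ℝ] ℝ)} (hS : ∀ A, HasFDerivAt S (S' A) A)
    {n : ℕ} (c : Fin n → ι)
    (hint : Integrable (fun A => (∏ k, A (c k)) * Real.exp (-S A)))
    (hintA : ∀ j, Integrable (fun A => A j * ((∏ k, A (c k)) * Real.exp (-S A))))
    (hintG' : ∀ i k, Integrable
      (fun A => affineField M v A i * ((∏ j ∈ Finset.univ.erase k, A (c j)) * Real.exp (-S A))))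
    (hintS' : ∀ i, Integrable
      (fun A => affineField M v A i * (S' A (Pi.single i 1) * ((∏ k, A (c k)) * Real.exp (-S A))))) :
    formalExpect S (fun A => ∑ k, (∏ j ∈ Finset.univ.erase k, A (c j)) * affineField M v A (c k)) =
      formalExpect S (fun A => (∏ k, A (c k)) * S' A (affineField M v A)) := by
  classical
  let G' : (ι → ℝ) → ((ι → ℝ) →L[ℝ] ℝ) :=
    fun A => ∑ k, (∏ j ∈ Finset.univ.erase k, A (c j)) • ContinuousLinearMap.proj (c k)
  have hG : ∀ A, HasFDerivAt (fun B : ι → ℝ => ∏ k, B (c k)) (G' A) A := by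
    intro A
    have h := HasFDerivAt.finsetProd (u := Finset.univ) (g := fun k (B : ι → ℝ) => B (c k))
      (g' := fun k => ContinuousLinearMap.proj (R := ℝ) (φ := fun _ : ι => ℝ) (c k)) (x := A)
      (fun k _ => (ContinuousLinearMap.proj (R := ℝ) (φ := fun _ : ι => ℝ) (c k)).hasFDerivAt)
    simpa [G'] using h
  have hG'apply : ∀ A w, G' A w = ∑ k, (∏ j ∈ Finset.univ.erase k, A (c j)) * w (c k) := by
    intro A w
    simp [G']
  have h := formalExpect_fderiv_eq M v hM hS hG hint hintA ?_ hintS'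
  · simpa [formalExpect, hG'apply] using h
  · intro i
    have : (fun A => affineField M v A i * (G' A (Pi.single i 1) * Real.exp (-S A))) =
        fun A => ∑ k, (if c k = i then (1 : ℝ) else 0) *
          (affineField M v A i * ((∏ j ∈ Finset.univ.erase k, A (c j)) * Real.exp (-S A))) := by
      funext A
      rw [hG'apply, Finset.sum_mul, Finset.mul_sum]
      refine Finset.sum_congr rfl fun k _ => ?_
      simp only [Pi.single_apply]
      split_ifs <;> ring
    rw [this]
    exact integrable_finsetSum _ fun k _ => (hintG' i k).const_mul _

omit [DecidableEq ι] in
/-- READING (FD): **an insertion with vanishing self-expectation vanishes identically** — if `X` and `S` are continuous and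
`⟨X·X⟩_S = 0` then `X ≡ 0` (the density `e^{−S}` is positive and Lebesgue measure charges every open set). Used in §4's
reading of precision (s): two hierarchies of the shape `formalExpect_ward_monomial` that hold for EVERY monomial and
differ by a polynomial insertion `X` force `⟨X·p⟩_S = 0` for every polynomial `p`, in particular `p = X`, hence `X ≡ 0`.
[cite: MagnenRivasseauSeneor1993, §VIII (VIII.2)–(VIII.5) p.377 tl.22–39] -/
theorem eq_zero_of_formalExpect_mul_self_eq_zero {S X : (ι → ℝ) → ℝ} (hX : Continuous X) (hS : Continuous S)
    (hint : Integrable (fun A => X A * X A * Real.exp (-S A)))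
    (h : formalExpect S (fun A => X A * X A) = 0) : X = 0 := by
  have hnn : 0 ≤ᵐ[volume] fun A => X A * X A * Real.exp (-S A) :=
    Filter.Eventually.of_forall fun A => mul_nonneg (mul_self_nonneg _) (Real.exp_pos _).le
  have hae : (fun A => X A * X A * Real.exp (-S A)) =ᵐ[volume] 0 :=
    (integral_eq_zero_iff_of_nonneg_ae hnn hint).1 (by simpa [formalExpect] using h)
  have hcont : Continuous fun A => X A * X A * Real.exp (-S A) := by fun_prop
  have heq : (fun A => X A * X A * Real.exp (-S A)) = 0 :=
    (Continuous.ae_eq_iff_eq volume hcont continuous_const).1 hae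
  funext A
  have hA := congrFun heq A
  simp only [Pi.zero_apply, mul_eq_zero, Real.exp_ne_zero, or_false] at hA
  exact mul_self_eq_zero.1 (by rcases hA with h1 | h1 <;> simp [h1])

end FormalLebesgue

/-! ## §2 The Jacobian of «A → A + Dγ» to first order: the linear part `A ↦ λ[γ, A]` is traceless (READING (FD-sites)) -/

section Sites

variable {X : Type*} [Fintype X] [DecidableEq X]

/-- On finitely many sites `x ∈ X` (each carrying one spatial component of the field, values in `su(2) ≅ ℝ³`), the
LINEAR PART of `A ↦ A + Dγ`, `A ↦ λ[γ, A]` sitewise (`D_mγ = ∂_mγ − λ[A_m, γ] = ∂_mγ + λ[γ, A_m]`), as a matrix on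
`X × Fin 3` with the printed structure constants. [cite: MagnenRivasseauSeneor1993, §II.A p.328 tl.27–33, (II.5) p.329, (VIII.2) p.377 tl.22] -/
def gaugeMatrix (lam : ℝ) (γ : X → Fin 3 → ℝ) : Matrix (X × Fin 3) (X × Fin 3) ℝ :=
  Matrix.of fun p q => if p.1 = q.1 then lam * ∑ b, eps p.2 b q.2 * γ p.1 b else 0

/-- The matrix acts as `λ[γ(x), A(x)]` at each site (the tree's printed bracket).
[cite: MagnenRivasseauSeneor1993, §II.A p.328 tl.32–33, (II.5) p.329] -/
theorem gaugeMatrix_mulVec (lam : ℝ) (γ : X → Fin 3 → ℝ) (A : X × Fin 3 → ℝ) (p : X × Fin 3) :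
    (gaugeMatrix lam γ).mulVec A p = lam * bracket (γ p.1) (fun c => A (p.1, c)) p.2 := by
  rcases p with ⟨x, a⟩
  simp only [Matrix.mulVec, dotProduct, gaugeMatrix, Matrix.of_apply, bracket]
  rw [Fintype.sum_prod_type]
  rw [Finset.sum_eq_single x]
  · simp only [if_true, Finset.mul_sum, Finset.sum_mul]
    rw [Finset.sum_comm]
    refine Finset.sum_congr rfl fun b _ => Finset.sum_congr rfl fun c _ => ?_
    ring
  · intro y _ hy; simp [Ne.symm hy]
  · intro h; exact absurd (Finset.mem_univ x) h

omit [DecidableEq X] in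
/-- `ε_{aba} = 0`. [cite: MagnenRivasseauSeneor1993, §II.A p.328 tl.32–33] -/
theorem eps_self_mid (a b : Fin 3) : eps a b a = 0 := by
  fin_cases a <;> fin_cases b <;> simp [eps]

/-- **The linear part of the infinitesimal gauge transformation is TRACELESS** — the Jacobian of `A ↦ A + tDγ` is
`1 + O(t²)`: «by (infinitesimal) gauge invariance, there is no first order dependence in γ» for the formal Lebesgue
measure; this is the hypothesis `trace M = 0` of §1. [cite: MagnenRivasseauSeneor1993, §VIII (VIII.1)–(VIII.2) p.377 tl.18–23] -/
theorem trace_gaugeMatrix (lam : ℝ) (γ : X → Fin 3 → ℝ) : (gaugeMatrix lam γ).trace = 0 := by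
  simp [Matrix.trace, gaugeMatrix, eps_self_mid]

end Sites

/-! ## §3 READING (J): the (VIII.2) density from the axial action `F²/4`, `A₀ ≡ 0` -/

/-- The axial gauge (II.7) «A₀ = 0» at the point, for a jet: the value `A₀(x)` and all first derivatives `∂_νA₀(x)`
vanish. [cite: MagnenRivasseauSeneor1993, §II.A (II.7) p.329 tl.20–21, (VIII.1) p.377 tl.15] -/
def IsAxialJet (A : FieldJet) : Prop := A.val 0 = 0 ∧ ∀ ν, A.der ν 0 = 0

/-- **The change of variables of Sect. VIII on the axial field**: the spatial components move along the infinitesimal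
gauge transformation, `A_m ↦ A_m + t·D_mγ` (`m = 1,2,3`, values and first derivatives, (II.5)), the deleted component
`A₀ ≡ 0` is untouched («the theory with gauge condition A₀ = 0», tl.15). «A → A + Dγ» is `t = 1`; «first order
dependence in γ» is the `t`-derivative at `0`. [cite: MagnenRivasseauSeneor1993, §VIII (VIII.1)–(VIII.2) p.377 tl.15–23, (II.5) p.329] -/
def axialLine (lam : ℝ) (A : FieldJet) (γ : GaugeJet) (t : ℝ) : FieldJet where
  val μ := if μ = 0 then A.val μ else A.val μ + t • covD lam A γ μ
  der ν μ := if μ = 0 then A.der ν μ else A.der ν μ + t • covDDer lam A γ ν μ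

/-- At `t = 0` the configuration is `A`. [cite: MagnenRivasseauSeneor1993, (VIII.2) p.377 tl.22] -/
theorem axialLine_zero (lam : ℝ) (A : FieldJet) (γ : GaugeJet) : axialLine lam A γ 0 = A := by
  cases A
  simp only [axialLine, zero_smul, add_zero, ite_self]

/-- The change of variables preserves the gauge condition `A₀ = 0`. [cite: MagnenRivasseauSeneor1993, (II.7) p.329, (VIII.1) p.377 tl.15] -/
theorem axialLine_isAxial (lam : ℝ) {A : FieldJet} (hA : IsAxialJet A) (γ : GaugeJet) (t : ℝ) :
    IsAxialJet (axialLine lam A γ t) := by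
  refine ⟨?_, fun ν => ?_⟩
  · simp [axialLine, hA.1]
  · simp [axialLine, hA.2 ν]

/-- `D_m ∂₀γ = ∂_m∂₀γ − λ[A_m, ∂₀γ]` — the covariant derivative (II.5) applied to `∂γ/∂x⁰`, the operator `D^{ab}_m ∂/∂x⁰`
of (VIII.2) acting on `γ^b`, at the point. [cite: MagnenRivasseauSeneor1993, (II.5) p.329 tl.10–11, (VIII.2) p.377 tl.25] -/
def covDTime (lam : ℝ) (A : FieldJet) (γ : GaugeJet) (m : Fin 4) : Fin 3 → ℝ :=
  γ.der2 m 0 - lam • bracket (A.val m) (γ.der 0)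

/-- **The second operator of (VIII.2), `[∂/∂x⁰ A^a_m · D^{ab}_m] ∂/∂x⁰`, applied to `γ^b`** (density at the point, `m`
summed over the spatial indices): `Σ_{m=1}^{3} Σ_a ∂₀A^a_m (D_m∂₀γ)^a`. [cite: MagnenRivasseauSeneor1993, §VIII (VIII.2) p.377 tl.25] -/
def opVIII2 (lam : ℝ) (A : FieldJet) (γ : GaugeJet) : ℝ :=
  ∑ i : Fin 3, ∑ a, A.der 0 i.succ a * covDTime lam A γ i.succ a

/-- **The source term of (VIII.2)/(VIII.3), `J^a_m(x)D^{ab}_m(x)` applied to `γ^b`**: `Σ_{m=1}^{3} Σ_a J^a_m (D_mγ)^a` (the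
value `J(x)` of the source at the point; `J₀` plays no role in the axial gauge). [cite: MagnenRivasseauSeneor1993, §VIII (VIII.2) p.377 tl.25] -/
def srcTerm (lam : ℝ) (J : Fin 4 → Fin 3 → ℝ) (A : FieldJet) (γ : GaugeJet) : ℝ :=
  ∑ i : Fin 3, ∑ a, J i.succ a * covD lam A γ i.succ a

/-- The density `J·A = Σ_{m=1}^{3} Σ_a J^a_m A^a_m` of the source exponent in (VIII.1).
[cite: MagnenRivasseauSeneor1993, §VIII (VIII.1) p.377 tl.17] -/
def pairing (J : Fin 4 → Fin 3 → ℝ) (A : FieldJet) : ℝ := ∑ i : Fin 3, ∑ a, J i.succ a * A.val i.succ a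

/-- Magnetic components along the change of variables coincide with those along the full line `A + tDγ` of
`…InfinitesimalGauge` (only spatial values and derivatives enter `F_mn`). [cite: MagnenRivasseauSeneor1993, (II.1) p.328, (VIII.2) p.377] -/
theorem curvature_axialLine_succ_succ (lam : ℝ) (A : FieldJet) (γ : GaugeJet) (t : ℝ) (i j : Fin 3) :
    curvature lam (axialLine lam A γ t) i.succ j.succ = curvature lam (gaugeLine lam A γ t) i.succ j.succ := by
  simp only [curvature, axialLine, gaugeLine_val, gaugeLine_der, Fin.succ_ne_zero, if_false]

/-- Electric components in the axial gauge: `F_0m(A + tDγ|_spatial) = ∂₀A_m + t·∂₀(D_mγ)`.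
[cite: MagnenRivasseauSeneor1993, (II.1) p.328, (II.9) p.330, (VIII.2) p.377] -/
theorem curvature_axialLine_zero_succ (lam : ℝ) {A : FieldJet} (hA : IsAxialJet A) (γ : GaugeJet) (t : ℝ)
    (i : Fin 3) :
    curvature lam (axialLine lam A γ t) 0 i.succ = A.der 0 i.succ + t • covDDer lam A γ 0 i.succ := by
  simp only [curvature, axialLine, Fin.succ_ne_zero, if_false, if_true, hA.1, hA.2]
  ext a
  simp [bracket_apply]

/-- … and `F_m0 = −F_0m`. [cite: MagnenRivasseauSeneor1993, (II.1) p.328, (VIII.2) p.377] -/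
theorem curvature_axialLine_succ_zero (lam : ℝ) {A : FieldJet} (hA : IsAxialJet A) (γ : GaugeJet) (t : ℝ)
    (i : Fin 3) :
    curvature lam (axialLine lam A γ t) i.succ 0 = -(A.der 0 i.succ + t • covDDer lam A γ 0 i.succ) := by
  rw [curvature_antisymm, curvature_axialLine_zero_succ lam hA]

/-- `F_00 = 0`. [cite: MagnenRivasseauSeneor1993, (II.1) p.328] -/
theorem curvature_axialLine_zero_zero (lam : ℝ) (A : FieldJet) (γ : GaugeJet) (t : ℝ) :
    curvature lam (axialLine lam A γ t) 0 0 = 0 := by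
  simp only [curvature, axialLine, if_true, sub_self, bracket_eq_crossProduct, cross_self, smul_zero]

/-- The scalar triple product is cyclic: `X·[Y, Z] = [X, Y]·Z` for the printed wedge product.
[cite: MagnenRivasseauSeneor1993, §II.A p.328 tl.32–33] -/
theorem dot_bracket_cyclic (X Y Z : Fin 3 → ℝ) : ∑ a, X a * bracket Y Z a = ∑ a, bracket X Y a * Z a := by
  simp only [bracket_apply, Fin.sum_univ_three]
  simp [eps]
  ring

/-- The electric linear coefficient IS the (VIII.2) density term: `∂₀A_m·∂₀(D_mγ) = ∂₀A_m·D_m(∂₀γ)` — the extra piece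
`−λ ∂₀A_m·[∂₀A_m, γ]` of the Leibniz rule vanishes (`X·[X, γ] = 0`) and `∂₀∂_mγ = ∂_m∂₀γ` (READING (K): `γ ∈ C²`).
[cite: MagnenRivasseauSeneor1993, §VIII (VIII.2) p.377 tl.22–25] -/
theorem dot_covDDer_eq_dot_covDTime (lam : ℝ) (A : FieldJet) {γ : GaugeJet} (hγ : γ.Symm) (m : Fin 4) :
    ∑ a, A.der 0 m a * covDDer lam A γ 0 m a = ∑ a, A.der 0 m a * covDTime lam A γ m a := by
  have h0 := dot_bracket_self (A.der 0 m) γ.val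
  simp only [covDDer, covDTime, hγ 0 m, Pi.sub_apply, Pi.smul_apply, smul_eq_mul, mul_sub,
    Finset.sum_sub_distrib]
  have : ∑ a, A.der 0 m a * (lam * bracket (A.der 0 m) γ.val a) =
      lam * ∑ a, A.der 0 m a * bracket (A.der 0 m) γ.val a := by
    rw [Finset.mul_sum]; exact Finset.sum_congr rfl fun a _ => by ring
  rw [this, h0, mul_zero, sub_zero]

/-- The `t⁰` coefficient of `Σ(F(A + tDγ|_spatial))²` in the axial gauge: `2Σ_m|∂₀A_m|² + Σ_{mn}|F_mn(A)|²` (= `Σ_{μν}|F_μν(A)|²`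
for an axial jet, `fieldStrengthSq_eq_S0`). [cite: MagnenRivasseauSeneor1993, (II.2) p.328, (II.9)–(II.10) p.330] -/
def S0 (lam : ℝ) (A : FieldJet) : ℝ :=
  2 * ∑ i : Fin 3, ∑ a, A.der 0 i.succ a ^ 2 + ∑ i : Fin 3, ∑ j : Fin 3, ∑ a, curvature lam A i.succ j.succ a ^ 2

/-- The `t²` coefficient (explicit; magnetic part from `…InfinitesimalGauge.remC0`). [cite: MagnenRivasseauSeneor1993, (VIII.2) p.377] -/
def C0 (lam : ℝ) (A : FieldJet) (γ : GaugeJet) : ℝ :=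
  2 * ∑ i : Fin 3, ∑ a, covDDer lam A γ 0 i.succ a ^ 2 + ∑ i : Fin 3, ∑ j : Fin 3, remC0 lam A γ i.succ j.succ

/-- The `t³` coefficient (explicit). [cite: MagnenRivasseauSeneor1993, (VIII.2) p.377] -/
def C1 (lam : ℝ) (A : FieldJet) (γ : GaugeJet) : ℝ := ∑ i : Fin 3, ∑ j : Fin 3, remC1 lam A γ i.succ j.succ

/-- The `t⁴` coefficient (explicit). [cite: MagnenRivasseauSeneor1993, (VIII.2) p.377] -/
def C2 (lam : ℝ) (A : FieldJet) (γ : GaugeJet) : ℝ := ∑ i : Fin 3, ∑ j : Fin 3, remC2 lam A γ i.succ j.succ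

/-- `Σ_a(u + tw)_a² = Σu² + 2tΣuw + t²Σw²` in `ℝ³`. [cite: MagnenRivasseauSeneor1993, (VIII.2) p.377] -/
theorem sum_sq_add_smul (u w : Fin 3 → ℝ) (t : ℝ) :
    ∑ a, (u + t • w) a ^ 2 = ∑ a, u a ^ 2 + 2 * t * ∑ a, u a * w a + t ^ 2 * ∑ a, w a ^ 2 := by
  simp only [Fin.sum_univ_three, Pi.add_apply, Pi.smul_apply, smul_eq_mul]
  ring

/-- **CLOSED FORM ALONG THE CHANGE OF VARIABLES.** For an axial jet `A` and `γ` with symmetric second derivatives,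
`Σ_{μν a}(F^a_μν(A + tDγ|_spatial))² = S₀ + t·(4·opVIII2) + t²·(C₀ + tC₁ + t²C₂)`: the magnetic pairs carry NO linear term
(`…InfinitesimalGauge.sum_sq_curvature_gaugeLine` — «by (infinitesimal) gauge invariance» in three dimensions at fixed
`x⁰`), the electric pairs `2Σ_m|∂₀A_m + t∂₀(D_mγ)|²` carry the linear term `4t Σ_m ∂₀A_m·D_m∂₀γ`.
[cite: MagnenRivasseauSeneor1993, §VIII (VIII.2) p.377 tl.22–25, (II.9) p.330] -/
theorem fieldStrengthSq_axialLine (lam : ℝ) {A : FieldJet} (hA : IsAxialJet A) {γ : GaugeJet} (hγ : γ.Symm)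
    (t : ℝ) :
    fieldStrengthSq lam (axialLine lam A γ t) =
      S0 lam A + t * (4 * opVIII2 lam A γ) + t ^ 2 * (C0 lam A γ + t * C1 lam A γ + t ^ 2 * C2 lam A γ) := by
  unfold fieldStrengthSq
  rw [Fin.sum_univ_succ]
  simp_rw [Fin.sum_univ_succ (f := fun ν => ∑ a, curvature lam (axialLine lam A γ t) _ ν a ^ 2)]
  simp_rw [curvature_axialLine_zero_zero, curvature_axialLine_zero_succ lam hA, curvature_axialLine_succ_zero lam hA,
    curvature_axialLine_succ_succ, sum_sq_curvature_gaugeLine lam A hγ t]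
  have hneg : ∀ i : Fin 3, ∑ a, (-(A.der 0 i.succ + t • covDDer lam A γ 0 i.succ)) a ^ 2 =
      ∑ a, (A.der 0 i.succ + t • covDDer lam A γ 0 i.succ) a ^ 2 := fun i =>
    Finset.sum_congr rfl fun a _ => by
      simp only [Pi.neg_apply, Pi.add_apply, Pi.smul_apply, smul_eq_mul]; ring
  simp_rw [hneg, sum_sq_add_smul, dot_covDDer_eq_dot_covDTime lam A hγ]
  simp only [S0, C0, C1, C2, opVIII2, Finset.sum_add_distrib, Finset.mul_sum, Pi.zero_apply,
    zero_pow two_ne_zero, Finset.sum_const_zero, zero_add]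
  simp only [Fin.sum_univ_three]
  ring

/-- For an axial jet, `Σ_{μν a}(F^a_μν(A))² = S₀ = 2Σ_m|∂₀A_m|² + Σ_{mn}|F_mn|²` — the split (II.9) «½∫F² = ½(A, p₀²A) + F_sp»
at the point. [cite: MagnenRivasseauSeneor1993, (II.9)–(II.10) p.330] -/
theorem fieldStrengthSq_eq_S0 (lam : ℝ) {A : FieldJet} (hA : IsAxialJet A) : fieldStrengthSq lam A = S0 lam A := by
  let γ0 : GaugeJet := ⟨0, 0, 0⟩
  have hγ0 : γ0.Symm := fun _ _ => rfl
  have h := fieldStrengthSq_axialLine lam hA hγ0 0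
  rw [axialLine_zero] at h
  simpa using h

/-- A real quartic `S + tL + t²(c₀ + tc₁ + t²c₂)` has derivative `L` at `t = 0`. [cite: MagnenRivasseauSeneor1993, (VIII.2) p.377 tl.22–23] -/
theorem hasDerivAt_quartic (S L c0 c1 c2 : ℝ) :
    HasDerivAt (fun t : ℝ => S + t * L + t ^ 2 * (c0 + t * c1 + t ^ 2 * c2)) L 0 := by
  have h := ((hasDerivAt_const (0 : ℝ) S).add ((hasDerivAt_id' (0 : ℝ)).mul_const L)).add
    (((hasDerivAt_id' (0 : ℝ)).pow 2).mul
      (((hasDerivAt_const (0 : ℝ) c0).add ((hasDerivAt_id' (0 : ℝ)).mul_const c1)).add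
        (((hasDerivAt_id' (0 : ℝ)).pow 2).mul_const c2)))
  refine (h.congr_of_eventuallyEq (Filter.Eventually.of_forall fun t => ?_)).congr_deriv ?_
  · simp only [Pi.add_apply, Pi.mul_apply, Pi.pow_apply]
  · norm_num

/-- **THE SECOND TERM OF (VIII.2) FROM THE AXIAL ACTION**: for an axial jet and `γ ∈ C²`,
`d/dt|_{t=0} ¼Σ_{μν a}(F^a_μν(A + tDγ|_spatial))² = Σ_{m=1}^{3} ∂₀A^a_m (D_m∂₀γ)^a` — the density of the first-order
variation of `F²/4` under the change of variables IS the displayed `[∂/∂x⁰ A^a_m · D^{ab}_m] ∂/∂x⁰` acting on `γ^b`, coefficient `1`.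
[cite: MagnenRivasseauSeneor1993, §VIII (VIII.1)–(VIII.2) p.377 tl.17–25] -/
theorem hasDerivAt_quarter_fieldStrengthSq_axialLine (lam : ℝ) {A : FieldJet} (hA : IsAxialJet A) {γ : GaugeJet}
    (hγ : γ.Symm) :
    HasDerivAt (fun t => (1 / 4 : ℝ) * fieldStrengthSq lam (axialLine lam A γ t)) (opVIII2 lam A γ) 0 := by
  simp_rw [fieldStrengthSq_axialLine lam hA hγ]
  have h := (hasDerivAt_quartic (S0 lam A) (4 * opVIII2 lam A γ) (C0 lam A γ) (C1 lam A γ) (C2 lam A γ)).const_mul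
    (1 / 4 : ℝ)
  refine h.congr_deriv ?_
  ring

/-- `J·(A + tDγ) = J·A + t·J·Dγ` (spatial components). [cite: MagnenRivasseauSeneor1993, §VIII (VIII.1)–(VIII.2) p.377] -/
theorem pairing_axialLine (lam : ℝ) (J : Fin 4 → Fin 3 → ℝ) (A : FieldJet) (γ : GaugeJet) (t : ℝ) :
    pairing J (axialLine lam A γ t) = pairing J A + t * srcTerm lam J A γ := by
  simp only [pairing, srcTerm, axialLine, Fin.succ_ne_zero, if_false, Pi.add_apply, Pi.smul_apply, smul_eq_mul,
    Finset.mul_sum, ← Finset.sum_add_distrib]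
  refine Finset.sum_congr rfl fun i _ => Finset.sum_congr rfl fun a _ => ?_
  ring

/-- The source exponent has first-order coefficient `J^a_m(D_mγ)^a`. [cite: MagnenRivasseauSeneor1993, §VIII (VIII.2) p.377 tl.25] -/
theorem hasDerivAt_pairing_axialLine (lam : ℝ) (J : Fin 4 → Fin 3 → ℝ) (A : FieldJet) (γ : GaugeJet) :
    HasDerivAt (fun t => pairing J (axialLine lam A γ t)) (srcTerm lam J A γ) 0 := by
  simp_rw [pairing_axialLine]
  have h := ((hasDerivAt_id' (0 : ℝ)).mul_const (srcTerm lam J A γ)).const_add (pairing J A)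
  simpa using h

/-- **(VIII.2) AS DISPLAYED, READING (J): the exponent `−F²/4 + J·A` of (VIII.1), carried along the change of variables
`A → A + tDγ` of the axial field, has first-order coefficient `J^a_m(D_mγ)^a − ∂₀A^a_m(D_m∂₀γ)^a` at the point** — the
bracket `(J^a_m(x)D^{ab}_m(x) − [∂/∂x⁰ A^a_m · D^{ab}_m] ∂/∂x⁰)` applied to `γ^b`, both signs as printed. Combined with §1
(`formalExpect_ward_generating`, `V = Dγ`, `dS[V] = ∫opVIII2`, `J·V = ∫srcTerm` under READING (J)'s un-typed `∫_Λ`) this is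
the formal Ward/Slavnov equation (VIII.2). [cite: MagnenRivasseauSeneor1993, §VIII (VIII.1)–(VIII.2) p.377 tl.14–25] -/
theorem hasDerivAt_exponent_axialLine (lam : ℝ) {A : FieldJet} (hA : IsAxialJet A) {γ : GaugeJet} (hγ : γ.Symm)
    (J : Fin 4 → Fin 3 → ℝ) :
    HasDerivAt (fun t => -((1 / 4 : ℝ) * fieldStrengthSq lam (axialLine lam A γ t)) + pairing J (axialLine lam A γ t))
      (srcTerm lam J A γ - opVIII2 lam A γ) 0 := by
  have h := (hasDerivAt_quarter_fieldStrengthSq_axialLine lam hA hγ).neg.add (hasDerivAt_pairing_axialLine lam J A γ)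
  refine h.congr_deriv ?_
  ring

/-! ## §4 The step (VIII.2) → (VIII.3): «Integrating by parts and taking into account the fact that A_mD_m = A_m ∂/∂x^m» -/

/-- The LEAD TERM `Σ_{m=1}^{3} ∂₀A^a_m ∂_m∂₀γ^a` of `opVIII2` — equal to the printed (VIII.3) density `(∂_mA^b_m)(∂₀²γ^b)`
MODULO TOTAL DERIVATIVES (one integration by parts in `x⁰`, one in `x^m`; not expressible on 1-jets of `A`).
[cite: MagnenRivasseauSeneor1993, §VIII (VIII.2)–(VIII.3) p.377 tl.25–27] -/
def leadVIII3 (A : FieldJet) (γ : GaugeJet) : ℝ := ∑ i : Fin 3, ∑ a, A.der 0 i.succ a * γ.der2 i.succ 0 a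

/-- The RESIDUAL `λ Σ_{m=1}^{3} [A_m, ∂₀A_m]·∂₀γ` of the step (VIII.2) → (VIII.3): what the sentence «A_mD_m = A_m∂_m»
would remove if the factor left of `D_m` were `A_m`; after the change of variables it is `∂₀A_m`.
[cite: MagnenRivasseauSeneor1993, §VIII (VIII.2)–(VIII.3) p.377 tl.25–27] -/
def residual (lam : ℝ) (A : FieldJet) (γ : GaugeJet) : ℝ :=
  lam * ∑ i : Fin 3, ∑ a, bracket (A.val i.succ) (A.der 0 i.succ) a * γ.der 0 a

/-- **The second operator of (VIII.3), `[∂/∂x^m A^b_m(x)](∂/∂x⁰)²`, applied to `γ^b`** (density at the point):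
`Σ_{m=1}^{3} Σ_b (∂_mA^b_m)(∂₀∂₀γ^b)`. [cite: MagnenRivasseauSeneor1993, §VIII (VIII.3) p.377 tl.27] -/
def opVIII3 (A : FieldJet) (γ : GaugeJet) : ℝ := ∑ i : Fin 3, ∑ b, A.der i.succ i.succ b * γ.der2 0 0 b

/-- Per spatial index, exactly: `∂₀A_m·D_m∂₀γ = ∂₀A_m·∂_m∂₀γ + λ[A_m, ∂₀A_m]·∂₀γ` (`−λ∂₀A_m·[A_m, ∂₀γ] = −λ[∂₀A_m, A_m]·∂₀γ`
by cyclicity, `= +λ[A_m, ∂₀A_m]·∂₀γ` by antisymmetry). [cite: MagnenRivasseauSeneor1993, §VIII (VIII.2)–(VIII.3) p.377 tl.25–27] -/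
theorem dot_covDTime (lam : ℝ) (A : FieldJet) (γ : GaugeJet) (m : Fin 4) :
    ∑ a, A.der 0 m a * covDTime lam A γ m a =
      ∑ a, A.der 0 m a * γ.der2 m 0 a + lam * ∑ a, bracket (A.val m) (A.der 0 m) a * γ.der 0 a := by
  have hc := dot_bracket_cyclic (A.der 0 m) (A.val m) (γ.der 0)
  have hs : ∀ a, bracket (A.der 0 m) (A.val m) a = -bracket (A.val m) (A.der 0 m) a := fun a => by
    rw [bracket_swap]; rfl
  simp only [covDTime, Pi.sub_apply, Pi.smul_apply, smul_eq_mul, mul_sub, Finset.sum_sub_distrib]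
  have : ∑ a, A.der 0 m a * (lam * bracket (A.val m) (γ.der 0) a) =
      lam * ∑ a, A.der 0 m a * bracket (A.val m) (γ.der 0) a := by
    rw [Finset.mul_sum]; exact Finset.sum_congr rfl fun a _ => by ring
  rw [this, hc]
  simp only [hs, neg_mul, Finset.sum_neg_distrib, mul_neg, sub_neg_eq_add]

/-- **EXACT DECOMPOSITION OF THE (VIII.2) TERM: `Σ_m ∂₀A_m·D_m∂₀γ = Σ_m ∂₀A_m·∂_m∂₀γ + λΣ_m [A_m, ∂₀A_m]·∂₀γ`**
(`opVIII2 = leadVIII3 + residual`) for every jet and every `λ`. The print's (VIII.3) keeps the lead term (as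
`(∂_mA_m)∂₀²γ` after two integrations by parts) and has no residual term. [cite: MagnenRivasseauSeneor1993, §VIII (VIII.2)–(VIII.3) p.377 tl.25–27] -/
theorem opVIII2_eq (lam : ℝ) (A : FieldJet) (γ : GaugeJet) :
    opVIII2 lam A γ = leadVIII3 A γ + residual lam A γ := by
  simp only [opVIII2, leadVIII3, residual, dot_covDTime, Finset.sum_add_distrib, Finset.mul_sum]

/-- **«the fact that A_mD_m = A_m ∂/∂x^m»** (tl.26) applied to `∂₀γ`: `A_m·D_m∂₀γ = A_m·∂_m∂₀γ` — TRUE, the dropped piece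
being `A_m·[A_m, ∂₀γ] = 0` (companion of `…InfinitesimalGauge.dot_covD_eq_dot_der`). Contrast `dot_covDTime`: with `∂₀A_m`
in place of the left `A_m` a residual remains. [cite: MagnenRivasseauSeneor1993, §VIII p.377 tl.26] -/
theorem dot_covDTime_eq (lam : ℝ) (A : FieldJet) (γ : GaugeJet) (m : Fin 4) :
    ∑ a, A.val m a * covDTime lam A γ m a = ∑ a, A.val m a * γ.der2 m 0 a := by
  have h := dot_bracket_self (A.val m) (γ.der 0)
  simp only [covDTime, Pi.sub_apply, Pi.smul_apply, smul_eq_mul, mul_sub, Finset.sum_sub_distrib]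
  have : ∑ a, A.val m a * (lam * bracket (A.val m) (γ.der 0) a) =
      lam * ∑ a, A.val m a * bracket (A.val m) (γ.der 0) a := by
    rw [Finset.mul_sum]; exact Finset.sum_congr rfl fun a _ => by ring
  rw [this, h, mul_zero, sub_zero]

/-- At zero coupling the residual vanishes and (VIII.2) → (VIII.3) is exact integration by parts.
[cite: MagnenRivasseauSeneor1993, §VIII (VIII.2)–(VIII.3) p.377 tl.25–27] -/
theorem residual_zero_coupling (A : FieldJet) (γ : GaugeJet) : residual 0 A γ = 0 := by
  simp [residual]

/-- A gauge parameter INDEPENDENT OF `x⁰` at the point: `∂₀γ = 0` and `∂_μ∂₀γ = 0` — the residual invariance of the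
axial gauge, «the gauge transformations independent of x⁰, the "time coordinate." We do not fix this remaining invariance
yet» (p.329 tl.29–32). [cite: MagnenRivasseauSeneor1993, §II.A p.329 tl.29–32] -/
def IsStaticJet (γ : GaugeJet) : Prop := γ.der 0 = 0 ∧ ∀ μ, γ.der2 μ 0 = 0

/-- For `x⁰`-independent `γ` the (VIII.2) second term vanishes at the point: the Ward equation reduces to `⟨J·Dγ e^{J·A}⟩ = 0`,
the residual (time-independent) gauge invariance of the axial gauge. [cite: MagnenRivasseauSeneor1993, §II.A p.329 tl.29–32, §VIII (VIII.2) p.377] -/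
theorem opVIII2_eq_zero_of_static (lam : ℝ) (A : FieldJet) {γ : GaugeJet} (h : IsStaticJet γ) :
    opVIII2 lam A γ = 0 := by
  simp [opVIII2, covDTime, h.1, h.2, bracket_eq_crossProduct]

/-- … so does the residual: precision (s) below concerns only the `x⁰`-dependence of `γ`.
[cite: MagnenRivasseauSeneor1993, §II.A p.329 tl.29–32, §VIII (VIII.2)–(VIII.3) p.377] -/
theorem residual_eq_zero_of_static (lam : ℝ) (A : FieldJet) {γ : GaugeJet} (h : IsStaticJet γ) :
    residual lam A γ = 0 := by
  simp [residual, h.1]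

/-- … and the printed (VIII.3) term. [cite: MagnenRivasseauSeneor1993, §VIII (VIII.3) p.377] -/
theorem opVIII3_eq_zero_of_static (A : FieldJet) {γ : GaugeJet} (h : IsStaticJet γ) : opVIII3 A γ = 0 := by
  simp [opVIII3, h.2 0]

/-! ### PRECISION (s), READING (1D): an `x⃗`-independent periodic configuration on which the residual's period
integral is `λπ` while the lead term and the printed (VIII.3) term vanish identically -/

/-- WITNESS FIELD: the jet, at a point with `x⁰ = t`, of the smooth `2π`-periodic `x⃗`-independent axial configuration
`A₁(x) = t₁ + sin x⁰·t₂`, `A₂ = A₃ = 0`, `A₀ = 0` (colour basis `t₁, t₂, t₃`): value `A₁ = (1, sin t, 0)`, the only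
non-zero derivative `∂₀A₁ = (0, cos t, 0)`. [cite: MagnenRivasseauSeneor1993, §VIII (VIII.2)–(VIII.3) p.377 tl.25–27] -/
def wA (t : ℝ) : FieldJet where
  val μ := if μ = 1 then ![1, Real.sin t, 0] else 0
  der ν μ := if ν = 0 ∧ μ = 1 then ![0, Real.cos t, 0] else 0

/-- WITNESS GAUGE PARAMETER: the 2-jet at the same point of `γ(x) = sin x⁰·t₃`: `γ = (0,0,sin t)`, `∂₀γ = (0,0,cos t)`,
`∂₀∂₀γ = (0,0,−sin t)`, all other derivatives zero. [cite: MagnenRivasseauSeneor1993, §VIII (VIII.2)–(VIII.3) p.377 tl.22–27] -/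
def wγ (t : ℝ) : GaugeJet where
  val := ![0, 0, Real.sin t]
  der ν := if ν = 0 then ![0, 0, Real.cos t] else 0
  der2 ν μ := if ν = 0 ∧ μ = 0 then ![0, 0, -Real.sin t] else 0

/-- The witness field is axial. [cite: MagnenRivasseauSeneor1993, (II.7) p.329] -/
theorem wA_isAxial (t : ℝ) : IsAxialJet (wA t) := by
  refine ⟨by simp [wA], fun ν => by simp [wA]⟩

/-- The witness parameter has symmetric second derivatives (it is smooth). [cite: MagnenRivasseauSeneor1993, (II.5) p.329] -/
theorem wγ_symm (t : ℝ) : (wγ t).Symm := by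
  intro μ ν
  simp only [wγ]
  by_cases hμ : μ = 0 <;> by_cases hν : ν = 0 <;> simp [hμ, hν]

/-- On the witness the (VIII.2) density is `λcos²x⁰` (only `m = 1`: `∂₀A₁·(−λ[A₁, ∂₀γ]) = −λ det(∂₀A₁, A₁, ∂₀γ) = λcos²t`).
[cite: MagnenRivasseauSeneor1993, §VIII (VIII.2) p.377 tl.25] -/
theorem opVIII2_witness (lam t : ℝ) : opVIII2 lam (wA t) (wγ t) = lam * Real.cos t ^ 2 := by
  simp [opVIII2, covDTime, wA, wγ, Fin.sum_univ_three, bracket_apply, eps]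
  ring

/-- On the witness the lead term `∂₀A_m·∂_m∂₀γ` vanishes identically (nothing depends on `x⃗`).
[cite: MagnenRivasseauSeneor1993, §VIII (VIII.2)–(VIII.3) p.377 tl.25–27] -/
theorem leadVIII3_witness (t : ℝ) : leadVIII3 (wA t) (wγ t) = 0 := by
  simp [leadVIII3, wA, wγ]

/-- … so the whole (VIII.2) density is residual there: `λ[A₁, ∂₀A₁]·∂₀γ = λcos²x⁰`.
[cite: MagnenRivasseauSeneor1993, §VIII (VIII.2)–(VIII.3) p.377 tl.25–27] -/
theorem residual_witness (lam t : ℝ) : residual lam (wA t) (wγ t) = lam * Real.cos t ^ 2 := by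
  have h := opVIII2_eq lam (wA t) (wγ t)
  rw [opVIII2_witness, leadVIII3_witness, zero_add] at h
  exact h.symm

/-- On the witness the printed (VIII.3) density `(∂_mA^b_m)(∂₀²γ^b)` vanishes identically (`∂_mA_m = 0`).
[cite: MagnenRivasseauSeneor1993, §VIII (VIII.3) p.377 tl.27] -/
theorem opVIII3_witness (t : ℝ) : opVIII3 (wA t) (wγ t) = 0 := by
  simp only [opVIII3, wA, wγ, Fin.sum_univ_three]
  simp

/-- **PRECISION (s), the (VIII.2) side: over one period in `x⁰` — where «integrating by parts» has no boundary term —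
the (VIII.2) operator applied to the witness `γ` integrates to `λπ`** (`∫₀^{2π} λcos² = λπ`, Mathlib `integral_cos_sq`).
[cite: MagnenRivasseauSeneor1993, §VIII (VIII.2)–(VIII.3) p.377 tl.25–27] -/
theorem integral_opVIII2_witness (lam : ℝ) :
    ∫ t in (0 : ℝ)..2 * Real.pi, opVIII2 lam (wA t) (wγ t) = lam * Real.pi := by
  simp_rw [opVIII2_witness]
  rw [intervalIntegral.integral_const_mul, integral_cos_sq]
  simp

/-- The lead term's period integral is `0` on the witness (it vanishes pointwise). [cite: MagnenRivasseauSeneor1993, §VIII (VIII.2)–(VIII.3) p.377 tl.25–27] -/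
theorem integral_leadVIII3_witness : ∫ t in (0 : ℝ)..2 * Real.pi, leadVIII3 (wA t) (wγ t) = 0 := by
  simp_rw [leadVIII3_witness]
  simp

/-- **PRECISION (s), the (VIII.3) side: the printed (VIII.3) operator applied to the witness `γ` integrates to `0`.**
[cite: MagnenRivasseauSeneor1993, §VIII (VIII.3) p.377 tl.27] -/
theorem integral_opVIII3_witness : ∫ t in (0 : ℝ)..2 * Real.pi, opVIII3 (wA t) (wγ t) = 0 := by
  simp_rw [opVIII3_witness]
  simp

/-- **PRECISION (s), stated: for `λ ≠ 0` the two displayed second operators of (VIII.2) and (VIII.3), applied to the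
witness `γ` and integrated over a period (the source terms `J^a_m D^{ab}_m` being identical in both displays), DIFFER on
the witness field** — the integrands of (VIII.2) and (VIII.3) differ, as functionals of `A`, by
`X_γ(A) = λ∫⟨[A_m, ∂₀A_m], ∂₀γ⟩`, not identically zero; (VIII.3) follows from (VIII.2) together with `⟨X_γ e^{J·A}⟩_ax = 0`,
which is not the quoted «A_mD_m = A_m∂_m». Not adjudicated (Sect. VIII is formal, p.377 tl.15; a sketch, p.378 tl.25).
[cite: MagnenRivasseauSeneor1993, §VIII (VIII.2)–(VIII.3) p.377 tl.22–27] -/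
theorem integral_opVIII2_ne_opVIII3_witness {lam : ℝ} (hlam : lam ≠ 0) :
    ∫ t in (0 : ℝ)..2 * Real.pi, opVIII2 lam (wA t) (wγ t) ≠ ∫ t in (0 : ℝ)..2 * Real.pi, opVIII3 (wA t) (wγ t) := by
  rw [integral_opVIII2_witness, integral_opVIII3_witness]
  exact mul_ne_zero hlam Real.pi_ne_zero

end AxialWard

end Literature.MathematicalPhysics.QuantumFieldTheory.MagnenRivasseauSeneor1993
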